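import Mathlib
import Literature.Computability.AlgebraicComplexity.FSV18Lemma55Safe
import HarnessLib

/-!
# FSV 2018 Lemma 55 (the Forbes–Shpilka generator for roABPs) AS PRINTED — proof
# (`ForbesShpilkaVolk2018_lemma55_allFields`; PRINT-ERRATA B13 resolved: the verbatim statement is true)

M. A. Forbes, A. Shpilka, B. L. Volk, *Succinct hitting sets and barriers to proving lower bounds
for algebraic circuits*, ToC 14(18) (2018) = arXiv:1701.05328 [ForbesShpilkaVolk2018], Lemma 55
(seq.; = ToC Lemma 7.1), after M. A. Forbes, A. Shpilka, FOCS 2013 = arXiv:1209.2408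
[ForbesShpilka2013], §3.2 (Construction 15, Lemmas 16–20, Thm. 21 in the arXiv numbering).

The cell typed FSV's sentence verbatim as the named fact `ForbesShpilkaVolk2018_lemma55`
(`FSV2018ROABP.lean`): the map `𝒢^{FS}` of eq. (7.1) = `fsGenCoord n w d ω β` — exponent
`2^{i-1}·d·w²` at seed `i`, `ω` of order `≥ (N d w²)²`, distinct nodes `β` — is a hitting-set
generator for width-`w`, individual-degree-`≤ d`, `N = 2ⁿ`-variate roABPs in the binary order. The
caveat B13 recorded that [FS13] proves this literally only for its own conventions (individual
degree `< n`, exponent `2^i n r²`, i.e. FSV's `d ↦ d+1`), and `FSV18Lemma55Safe.lean` proves that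
safe reading (`ForbesShpilkaVolk2018_lemma55_safe`). THIS FILE PROVES THE STATEMENT AS PRINTED:

* the merging step (FS13 Lemma 3.6 / arXiv 12, `FS2013.card_lt_of_not_span_evalProd_le`) needs
  the half products `R(x) = ∏_j M_j(f_j(x))` to have degree STRICTLY below the Kronecker exponent;
  the curves `f_j(s) = 𝒢^{(n)}_j(α', s)` are combinations of the Lagrange polynomials on `w²` nodes,
  of degree `w² - 1` (not `w²`), and for `n = 0` the identity, of degree `1 ≤ w² - 1` when `w ≥ 2`;
  so `deg R ≤ 2ⁿ·d·(w² - 1) < 2ⁿ·d·w²` = FSV's exponent as soon as `d ≥ 1`, `w ≥ 2`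
  (`FS2013.natDegree_fsGenCoord_lastCurve_le_pred`, `FS2013.span_layerProd_le_span_lastSeed_sharp`
  — the latter is `FS2013.span_layerProd_le_span_lastSeed` re-run with the sharp count, in the
  common-prefix form of arXiv Lemma 19);
* width `w = 1`: a width-1 roABP is a product of univariates and `𝒢^{FS}_m(v) ∈ {ω v_0, (ω v_0)^d}`
  (`FS2013.eval_fsGenCoord_width_one`), so a seed avoiding finitely many roots hits;
* degree `d = 0`: the roABP is a nonzero constant, hit by every generator
  (`FS2013.isHittingSetGenerator_of_isROABP_zero`);
* the field-size-free statement follows by base change to `Frac(F[u])` exactly as in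
  `ForbesShpilkaVolk2018_lemma55_safe` (`FS2013.map_fsGenCoord`, `FS2013.isROABP_map`).

Consequences: `ForbesShpilkaVolk2018_lemma55_allFields (F) : ForbesShpilkaVolk2018_lemma55 F`
(every field; the naming follows `ForbesShpilkaVolk2018_lemma52_allFields` — the fact is a per-field
`Prop`, so its discharge necessarily carries the field binder), and the printed Cor. 59 / Cor. 60
hypothesis-free (`ForbesShpilkaVolk2018_cor59_unconditional`, `ForbesShpilkaVolk2018_cor60_unconditional`,
`ForbesShpilkaVolk2018_cor60'_unconditional`; FSV Thm. 10 is already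
`FSV2018_thm10_holds`, `FSV18Thm10Holds.lean`, via the safe generator). No definitions, no named
facts. Honest framing: a 2013 PIT theorem re-proved in the kernel with FSV's 2018 constants;
nothing here bears on `VP ≠ VNP`.

## References
* [ForbesShpilkaVolk2018] Lemma 55, eq. (7.1), Cor. 59, Cor. 60 (seq.; = ToC Lemma 7.1, Cor. 7.5,
  Cor. 7.6) (locator: paper:arxiv-1701.05328 chunk p0023.txt:L9–L25, p0023.txt:L88 – p0024.txt:L6).
* [ForbesShpilka2013] arXiv:1209.2408 §3.2, Lemmas 16, 19, 20 (locator: paper:arxiv-1209.2408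
  p0015.txt:L35 – p0017.txt:L4).
-/

noncomputable section

open MvPolynomial Finset

open scoped BigOperators Pointwise

namespace Literature.Computability.AlgebraicComplexity

namespace FS2013

/-! ### The sharp degree of the last-seed curve: `≤ w² - 1` (arXiv Lemma 16, second bullet) -/

section SharpDegree

variable {F : Type*} [Field F] {n w : ℕ}

/-- `deg p_ℓ ≤ w² - 1` for all the basis polynomials when `w ≥ 2`: the Lagrange polynomials on
`w²` nodes have degree `≤ w² - 1`, and `p_{ℓ_{-1}}(t) = t` has degree `1 ≤ w² - 1` ([FS13] only
records "`deg(p_{ℓ_i}) ≤ r²` (even for `p_{ℓ_{-1}}`, as `r ≥ 1`)"; the sharper count is what FSV's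
constants need). [cite: ForbesShpilka2013, Lemma 16 (arXiv numbering; §3.2), proof]
locator: paper:arxiv-1209.2408 p0015.txt:L44 -/
theorem natDegree_fsBasis_le_pred (hw : 2 ≤ w) (β : Fin (w ^ 2) → F) (o : Option (Fin (w ^ 2))) :
    (fsBasis β o).natDegree ≤ w ^ 2 - 1 := by
  classical
  cases o with
  | none =>
    show (Polynomial.X : Polynomial F).natDegree ≤ w ^ 2 - 1
    rw [Polynomial.natDegree_X]
    have h4 : 2 * 2 ≤ w ^ 2 := by rw [pow_two]; exact Nat.mul_le_mul hw hw
    omega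
  | some ℓ =>
    show (Lagrange.basis Finset.univ β ℓ).natDegree ≤ w ^ 2 - 1
    unfold Lagrange.basis
    refine (Polynomial.natDegree_prod_le _ _).trans ?_
    have hle : ∑ j ∈ Finset.univ.erase ℓ, (Lagrange.basisDivisor (β ℓ) (β j)).natDegree ≤
        ∑ j ∈ Finset.univ.erase ℓ, (1 : ℕ) := by
      refine Finset.sum_le_sum fun j _ => ?_
      by_cases h : β ℓ = β j
      · rw [h, Lagrange.natDegree_basisDivisor_self]; exact Nat.zero_le _
      · exact (Lagrange.natDegree_basisDivisor_of_ne h).le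
    refine hle.trans ?_
    rw [Finset.sum_const, smul_eq_mul, mul_one, Finset.card_erase_of_mem (Finset.mem_univ _),
      Finset.card_univ, Fintype.card_fin]

/-- **[FS13, arXiv Lemma 16, second bullet] sharpened for FSV's (7.1):** `deg_{y_n} 𝒢^{(n)}_m ≤
w² - 1` (`w ≥ 2`) — the last seed enters only through the factor `p_{ℓ_n}(y_n)`.
[cite: ForbesShpilka2013, Lemma 16 (arXiv numbering; §3.2), second bullet]
locator: paper:arxiv-1209.2408 p0015.txt:L40–L47 -/
theorem degreeOf_last_fsGenCoord_le_pred (hw : 2 ≤ w) (n d : ℕ) (ω : F) (β : Fin (w ^ 2) → F)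
    (m : multilinearMonomials n) :
    (fsGenCoord n w d ω β m).degreeOf (Fin.last n) ≤ w ^ 2 - 1 := by
  classical
  unfold fsGenCoord
  refine (MvPolynomial.degreeOf_sum_le _ _ _).trans (Finset.sup_le fun ℓ _ => ?_)
  refine (MvPolynomial.degreeOf_mul_le _ _ _).trans ?_
  have hx : (∏ i : Fin n,
      (if (m : Fin n →₀ ℕ) i = 0 then
        Polynomial.aeval (fsArg ω ℓ i) (fsBasis β (fsIdx ℓ i.castSucc))
       else
        Polynomial.aeval (fsArg ω ℓ i ^ (2 ^ (i : ℕ) * d * w ^ 2))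
          (fsBasis β (fsIdx ℓ i.castSucc)))).degreeOf (Fin.last n) = 0 := by
    refine Nat.eq_zero_of_le_zero ((MvPolynomial.degreeOf_prod_le _ _ _).trans ?_)
    refine (Finset.sum_eq_zero fun i _ => ?_).le
    split_ifs
    · simpa only [pow_one] using degreeOf_last_aeval_fsArg_pow ω ℓ i 1 (fsBasis β (fsIdx ℓ i.castSucc))
    · exact degreeOf_last_aeval_fsArg_pow ω ℓ i _ _
  rw [hx, zero_add]
  refine (degreeOf_polynomial_aeval_le _ _ _).trans ?_
  rw [MvPolynomial.degreeOf_X, if_pos rfl, mul_one]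
  exact natDegree_fsBasis_le_pred hw β _

/-- The curve `s ↦ 𝒢^{(n)}_m(α', s)` in the last seed, as a univariate polynomial, has degree
`≤ w² - 1` (`w ≥ 2`). [cite: ForbesShpilka2013, Lemma 16 and Lemma 19 (arXiv numbering; §3.2)]
locator: paper:arxiv-1209.2408 p0016.txt:L52–L53 -/
theorem natDegree_fsGenCoord_lastCurve_le_pred (hw : 2 ≤ w) (n d : ℕ) (ω : F)
    (β : Fin (w ^ 2) → F) (m : multilinearMonomials n) (α' : Fin n → F) :
    (MvPolynomial.aeval (Fin.snoc (fun i : Fin n => Polynomial.C (α' i)) Polynomial.X :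
        Fin (n + 1) → Polynomial F) (fsGenCoord n w d ω β m)).natDegree ≤ w ^ 2 - 1 :=
  (natDegree_aeval_snoc_C_X_le α' _).trans (degreeOf_last_fsGenCoord_le_pred hw n d ω β m)

/-- The sharp degree of the half products is STRICTLY below FSV's Kronecker exponent:
`2ⁿ·d·(w² - 1) < 2ⁿ·d·w²` for `d ≥ 1`, `w ≥ 1` ([FS13, Lemma 12] needs "`R` … of degree `< Dnm`").
[cite: ForbesShpilka2013, Lemma 12 (arXiv numbering; §3.1), hypotheses] locator: paper:arxiv-1209.2408 p0014.txt:L23–L29 -/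
theorem two_pow_mul_pred_lt (n : ℕ) {d w : ℕ} (hd : 1 ≤ d) (hw : 0 < w) :
    2 ^ n * (d * (w ^ 2 - 1)) < 2 ^ n * d * w ^ 2 := by
  have hw2 : 1 ≤ w ^ 2 := Nat.one_le_pow _ _ hw
  rw [mul_assoc]
  refine Nat.mul_lt_mul_of_pos_left ?_ (Nat.two_pow_pos n)
  rw [Nat.mul_sub, mul_one]
  exact Nat.sub_lt (Nat.mul_pos hd hw2) hd

end SharpDegree

/-! ### Span preservation with FSV's own parameters (arXiv Lemma 19, common-prefix form) -/

section Span

variable {K : Type*} [Field K]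

/-- `j < 2ⁿ ⇒ j < 2ⁿ⁺¹`. [folklore] -/
private theorem lt_two_pow_succ {n j : ℕ} (hj : j < 2 ^ n) : j < 2 ^ (n + 1) :=
  lt_of_lt_of_le hj (Nat.pow_le_pow_right (by norm_num) (Nat.le_succ n))

/-- `j < 2ⁿ ⇒ 2ⁿ + j < 2ⁿ⁺¹`. [folklore] -/
private theorem add_lt_two_pow_succ {n j : ℕ} (hj : j < 2 ^ n) : 2 ^ n + j < 2 ^ (n + 1) := by
  rw [pow_succ]; omega

/-- A set all of whose finite subsets have `< B` elements is finite. [folklore] -/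
private theorem set_finite_of_card_lt {L : Type*} {B : ℕ} (s : Set L)
    (h : ∀ S : Finset L, ↑S ⊆ s → S.card < B) : s.Finite := by
  by_contra hs
  obtain ⟨S, hS, hcard⟩ := Set.Infinite.exists_subset_card_eq hs B
  exact absurd (h S hS) (by rw [hcard]; exact lt_irrefl B)

/-- **[ForbesShpilka2013, Lemma 19 (arXiv), "span preserving" — common-prefix form, with FSV's
OWN parameters (exponent `2^{i-1} d w²`, individual degree `≤ d`).** For `w ≥ 2`, `d ≥ 1` and
every finite family of `2ⁿ`-layer sequences of degree `≤ d` there is a common seed prefix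
`α' ∈ K^n` such that for each member the products along the generator's LAST-seed curve already
span all products of evaluations:
`span{∏_j M_j(x_j)}_{x ∈ K^{2ⁿ}} ⊆ span{∏_j M_j(𝒢^{(n)}_j(α', s))}_{s ∈ K}` — the same statement and
proof as `FS2013.span_layerProd_le_span_lastSeed` (the safe reading `d ↦ d+1` in the generator),
run with the SHARP degree count: the curves `s ↦ 𝒢^{(n)}_j(α', s)` have degree `≤ w² - 1` (not
`w²`), so the half products `R, T` have degree `≤ 2ⁿ·d·(w² - 1) < 2ⁿ·d·w² =` FSV's Kronecker
exponent, which is all the merging Lemma 3.6 (`FS2013.card_lt_of_not_span_evalProd_le`) needs.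
[cite: ForbesShpilka2013, Lemma 19 (arXiv numbering; §3.2), proof; ForbesShpilkaVolk2018, Lemma 55 eq. (7.1) (exponent `2^{i-1} d w²`)]
locator: paper:arxiv-1209.2408 p0016.txt:L31–L62; paper:arxiv-1701.05328 chunk p0023.txt:L19–L25 -/
theorem span_layerProd_le_span_lastSeed_sharp [Infinite K] {w d : ℕ} (hw2 : 2 ≤ w) (hd : 1 ≤ d)
    {ω : K} (hω0 : ω ≠ 0)
    {β : Fin (w ^ 2) → K} (hβ : Function.Injective β) :
    ∀ (n : ℕ), Set.InjOn (fun k : ℕ => ω ^ k)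
        (Set.Iio ((2 ^ n * d * w ^ 2) * (2 ^ n * d * w ^ 2))) →
      ∀ (ι : Type) [Fintype ι] (Ms : ι → Fin (2 ^ n) → Matrix (Fin w) (Fin w) (Polynomial K)),
        (∀ t j a b, (Ms t j a b).natDegree ≤ d) →
        ∃ α' : Fin n → K, ∀ t,
          Submodule.span K (Set.range fun x : Fin (2 ^ n) → K =>
              (List.ofFn fun j => (Ms t j).map (Polynomial.eval (x j))).prod) ≤
          Submodule.span K (Set.range fun s : K =>
              (List.ofFn fun j => (Ms t j).map (Polynomial.eval
                (MvPolynomial.eval (Fin.snoc α' s : Fin (n + 1) → K)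
                  (fsGenCoord n w d ω β (binaryOrder n j))))).prod) := by
  classical
  have hw : 0 < w := lt_of_lt_of_le two_pos hw2
  intro n
  induction n with
  | zero =>
    intro _ ι _ Ms _
    refine ⟨Fin.elim0, fun t => Submodule.span_mono ?_⟩
    rintro _ ⟨x, rfl⟩
    have hj0 : ∀ j : Fin (2 ^ 0), j = ⟨0, by norm_num⟩ := fun j => Fin.ext (by
      have := j.isLt; simp only [pow_zero] at this; omega)
    refine ⟨x ⟨0, by norm_num⟩, ?_⟩
    simp only
    congr 1
    congr 1
    funext j
    congr 2
    rw [fsGenCoord_zero, MvPolynomial.eval_X, hj0 j]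
    exact Fin.snoc_last (α := fun _ => K) _ _
  | succ n ih =>
    intro hω ι _ Ms hMs
    -- numerology: `E = 2ⁿ(d+1)w²` bounds the degree of a half product composed with the curves
    have hEle : 2 ^ n * d * w ^ 2 ≤ 2 ^ (n + 1) * d * w ^ 2 := by
      rw [pow_succ]
      exact Nat.mul_le_mul_right _ (Nat.mul_le_mul_right _ (Nat.le_mul_of_pos_right _ two_pos))
    have hω' : Set.InjOn (fun k : ℕ => ω ^ k)
        (Set.Iio ((2 ^ n * d * w ^ 2) * (2 ^ n * d * w ^ 2))) :=
      hω.mono (Set.Iio_subset_Iio (Nat.mul_le_mul hEle hEle))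
    -- induction hypothesis for the `2|ι|` half-sequences (last bit `0`: first half; `1`: second)
    obtain ⟨α'', hα''⟩ := ih hω' (ι ⊕ ι)
      (Sum.elim (fun t j => Ms t ⟨j, lt_two_pow_succ j.isLt⟩)
        (fun t j => Ms t ⟨2 ^ n + j, add_lt_two_pow_succ j.isLt⟩)) (by
      rintro (t | t) j a b
      · exact hMs t _ a b
      · exact hMs t _ a b)
    -- the curves `f_j(s) = 𝒢^{(n)}_j(α'', s)` of degree `≤ w² - 1` (the SHARP count)
    obtain ⟨f, hf_eval, hf_deg⟩ : ∃ f : Fin (2 ^ n) → Polynomial K,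
        (∀ j s, (f j).eval s = MvPolynomial.eval (Fin.snoc α'' s : Fin (n + 1) → K)
          (fsGenCoord n w d ω β (binaryOrder n j))) ∧
        ∀ j, (f j).natDegree ≤ w ^ 2 - 1 :=
      ⟨fun j => MvPolynomial.aeval (Fin.snoc (fun i : Fin n => Polynomial.C (α'' i)) Polynomial.X :
          Fin (n + 1) → Polynomial K) (fsGenCoord n w d ω β (binaryOrder n j)),
        fun j s => eval_aeval_snoc_C_X α'' _ s,
        fun j => natDegree_fsGenCoord_lastCurve_le_pred hw2 n d ω β (binaryOrder n j) α''⟩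
    -- `R(x) = ∏_j M_{(j,0)}(f_j(x))`, `T(y) = ∏_j M_{(j,1)}(f_j(y))`: degree `< E`, right values
    have hmk : ∀ (N : Fin (2 ^ n) → Matrix (Fin w) (Fin w) (Polynomial K)),
        (∀ j a b, (N j a b).natDegree ≤ d) →
        ∃ R : Matrix (Fin w) (Fin w) (Polynomial K),
          (∀ a b, (R a b).natDegree < 2 ^ n * d * w ^ 2) ∧
          ∀ s : K, R.map (Polynomial.eval s) = (List.ofFn fun j => (N j).map (Polynomial.eval
            (MvPolynomial.eval (Fin.snoc α'' s : Fin (n + 1) → K)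
              (fsGenCoord n w d ω β (binaryOrder n j))))).prod := by
      intro N hN
      refine ⟨(List.ofFn fun j => (N j).map fun p => p.comp (f j)).prod, fun a b => ?_, fun s => ?_⟩
      · have h1 := natDegree_listProd_ofFn_le (2 ^ n) (fun j => (N j).map fun p => p.comp (f j))
          (d * (w ^ 2 - 1)) (fun j a b => natDegree_map_comp_le (N j) (f j) (hN j) (hf_deg j) a b) a b
        exact lt_of_le_of_lt h1 (two_pow_mul_pred_lt n hd hw)
      · rw [← Polynomial.coe_evalRingHom, map_listProd_ofFn]
        refine congrArg (fun F : Fin (2 ^ n) → Matrix (Fin w) (Fin w) K => (List.ofFn F).prod)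
          (funext fun j => ?_)
        rw [Polynomial.coe_evalRingHom, map_comp_map_eval, hf_eval]
    choose Rf hRdeg hReval using fun t => hmk (fun j => Ms t ⟨j, lt_two_pow_succ j.isLt⟩)
      (fun j => hMs t _)
    choose Tf hTdeg hTeval using fun t => hmk (fun j => Ms t ⟨2 ^ n + j, add_lt_two_pow_succ j.isLt⟩)
      (fun j => hMs t _)
    -- the curves of level `n+1` through the evaluation points (`U(β_ℓ) = R(ω^ℓ α)`, …)
    have hnode0 : ∀ (α : K) (ℓ : Fin (w ^ 2)) (j : Fin (2 ^ n)),
        MvPolynomial.eval (Fin.snoc (Fin.snoc α'' (ω⁻¹ * α) : Fin (n + 1) → K) (β ℓ) :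
            Fin (n + 2) → K)
          (fsGenCoord (n + 1) w d ω β (binaryOrder (n + 1) ⟨j, lt_two_pow_succ j.isLt⟩)) =
        MvPolynomial.eval (Fin.snoc α'' (ω ^ (ℓ : ℕ) * α) : Fin (n + 1) → K)
          (fsGenCoord n w d ω β (binaryOrder n j)) := by
      intro α ℓ j
      rw [eval_fsGenCoord_succ_node n w d ω β hβ
        (binaryOrder (n + 1) ⟨j, lt_two_pow_succ j.isLt⟩) (binaryOrder n j)
        (fun i => (binaryOrder_succ_lower j i).symm) α'' (ω⁻¹ * α) ℓ,
        if_pos (binaryOrder_succ_lower_last j), pow_succ, mul_assoc, mul_inv_cancel_left₀ hω0]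
    have hnode1 : ∀ (α : K) (ℓ : Fin (w ^ 2)) (j : Fin (2 ^ n)),
        MvPolynomial.eval (Fin.snoc (Fin.snoc α'' (ω⁻¹ * α) : Fin (n + 1) → K) (β ℓ) :
            Fin (n + 2) → K)
          (fsGenCoord (n + 1) w d ω β
            (binaryOrder (n + 1) ⟨2 ^ n + j, add_lt_two_pow_succ j.isLt⟩)) =
        MvPolynomial.eval (Fin.snoc α'' ((ω ^ (ℓ : ℕ) * α) ^ (2 ^ n * d * w ^ 2)) :
            Fin (n + 1) → K)
          (fsGenCoord n w d ω β (binaryOrder n j)) := by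
      intro α ℓ j
      rw [eval_fsGenCoord_succ_node n w d ω β hβ
        (binaryOrder (n + 1) ⟨2 ^ n + j, add_lt_two_pow_succ j.isLt⟩) (binaryOrder n j)
        (fun i => (binaryOrder_succ_upper j i).symm) α'' (ω⁻¹ * α) ℓ,
        if_neg (by rw [binaryOrder_succ_upper_last j]; exact one_ne_zero), pow_succ, mul_assoc,
        mul_inv_cancel_left₀ hω0]
    -- node properties of `U_α(z) = ∏_j M_{(j,0)}(𝒢^{(n+1)}_{(j,0)}(α'', ω⁻¹α, z))`, `V_α` likewise
    have hUnode : ∀ (t : ι) (α : K) (ℓ : Fin (w ^ 2)),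
        (List.ofFn fun j : Fin (2 ^ n) => (Ms t ⟨j, lt_two_pow_succ j.isLt⟩).map (Polynomial.eval
          (MvPolynomial.eval
            (Fin.snoc (Fin.snoc α'' (ω⁻¹ * α) : Fin (n + 1) → K) (β ℓ) : Fin (n + 2) → K)
            (fsGenCoord (n + 1) w d ω β
              (binaryOrder (n + 1) ⟨j, lt_two_pow_succ j.isLt⟩))))).prod =
        (Rf t).map (Polynomial.eval (ω ^ (ℓ : ℕ) * α)) := by
      intro t α ℓ
      rw [hReval]
      exact congrArg (fun F : Fin (2 ^ n) → Matrix (Fin w) (Fin w) K => (List.ofFn F).prod)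
        (funext fun j => by rw [hnode0 α ℓ j])
    have hVnode : ∀ (t : ι) (α : K) (ℓ : Fin (w ^ 2)),
        (List.ofFn fun j : Fin (2 ^ n) => (Ms t ⟨2 ^ n + j, add_lt_two_pow_succ j.isLt⟩).map
          (Polynomial.eval (MvPolynomial.eval
            (Fin.snoc (Fin.snoc α'' (ω⁻¹ * α) : Fin (n + 1) → K) (β ℓ) : Fin (n + 2) → K)
            (fsGenCoord (n + 1) w d ω β
              (binaryOrder (n + 1) ⟨2 ^ n + j, add_lt_two_pow_succ j.isLt⟩))))).prod =
        (Tf t).map (Polynomial.eval ((ω ^ (ℓ : ℕ) * α) ^ (2 ^ n * d * w ^ 2))) := by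
      intro t α ℓ
      rw [hTeval]
      exact congrArg (fun F : Fin (2 ^ n) → Matrix (Fin w) (Fin w) K => (List.ofFn F).prod)
        (funext fun j => by rw [hnode1 α ℓ j])
    -- the bad values of the new twisted seed are finite for each member of the family
    have hBadfin : ∀ t, Set.Finite {α : K | ¬ Submodule.span K (Set.range fun xy : K × K =>
        (Rf t).map (Polynomial.eval xy.1) * (Tf t).map (Polynomial.eval xy.2)) ≤
      Submodule.span K (Set.range fun z : K =>
        (List.ofFn fun j : Fin (2 ^ n) => (Ms t ⟨j, lt_two_pow_succ j.isLt⟩).map (Polynomial.eval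
          (MvPolynomial.eval
            (Fin.snoc (Fin.snoc α'' (ω⁻¹ * α) : Fin (n + 1) → K) z : Fin (n + 2) → K)
            (fsGenCoord (n + 1) w d ω β
              (binaryOrder (n + 1) ⟨j, lt_two_pow_succ j.isLt⟩))))).prod *
        (List.ofFn fun j : Fin (2 ^ n) => (Ms t ⟨2 ^ n + j, add_lt_two_pow_succ j.isLt⟩).map
          (Polynomial.eval (MvPolynomial.eval
            (Fin.snoc (Fin.snoc α'' (ω⁻¹ * α) : Fin (n + 1) → K) z : Fin (n + 2) → K)
            (fsGenCoord (n + 1) w d ω β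
              (binaryOrder (n + 1) ⟨2 ^ n + j, add_lt_two_pow_succ j.isLt⟩))))).prod)} := by
      intro t
      refine set_finite_of_card_lt
        (B := ((2 ^ n * d * w ^ 2) * (2 ^ n * d * w ^ 2)) * (w * w)) _ fun S hS => ?_
      exact card_lt_of_not_span_evalProd_le hω' (Rf t) (Tf t) (hRdeg t) (hTdeg t) hw _ _
        (fun i : Fin (w * w) => β (Fin.cast (pow_two w).symm i))
        (fun α ℓ => hUnode t α (Fin.cast (pow_two w).symm ℓ))
        (fun α ℓ => hVnode t α (Fin.cast (pow_two w).symm ℓ)) S fun α hα => hS hα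
    obtain ⟨α, hα⟩ :=
      Infinite.exists_notMem_finset (Set.Finite.toFinset (Set.finite_iUnion hBadfin))
    have hgood : ∀ t, Submodule.span K (Set.range fun xy : K × K =>
        (Rf t).map (Polynomial.eval xy.1) * (Tf t).map (Polynomial.eval xy.2)) ≤
      Submodule.span K (Set.range fun z : K =>
        (List.ofFn fun j : Fin (2 ^ n) => (Ms t ⟨j, lt_two_pow_succ j.isLt⟩).map (Polynomial.eval
          (MvPolynomial.eval
            (Fin.snoc (Fin.snoc α'' (ω⁻¹ * α) : Fin (n + 1) → K) z : Fin (n + 2) → K)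
            (fsGenCoord (n + 1) w d ω β
              (binaryOrder (n + 1) ⟨j, lt_two_pow_succ j.isLt⟩))))).prod *
        (List.ofFn fun j : Fin (2 ^ n) => (Ms t ⟨2 ^ n + j, add_lt_two_pow_succ j.isLt⟩).map
          (Polynomial.eval (MvPolynomial.eval
            (Fin.snoc (Fin.snoc α'' (ω⁻¹ * α) : Fin (n + 1) → K) z : Fin (n + 2) → K)
            (fsGenCoord (n + 1) w d ω β
              (binaryOrder (n + 1) ⟨2 ^ n + j, add_lt_two_pow_succ j.isLt⟩))))).prod) := by
      intro t
      by_contra h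
      exact hα (by rw [Set.Finite.mem_toFinset, Set.mem_iUnion]; exact ⟨t, h⟩)
    -- assemble
    refine ⟨Fin.snoc α'' (ω⁻¹ * α), fun t => ?_⟩
    rw [Submodule.span_le]
    rintro _ ⟨x, rfl⟩
    rw [SetLike.mem_coe]
    have hsplit := listProd_ofFn_two_pow_succ (fun j => (Ms t j).map (Polynomial.eval (x j)))
    rw [show (fun x : Fin (2 ^ (n + 1)) → K =>
        (List.ofFn fun j => (Ms t j).map (Polynomial.eval (x j))).prod) x =
        (List.ofFn fun j => (Ms t j).map (Polynomial.eval (x j))).prod from rfl, hsplit]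
    -- each half lies in the span of the values of `R` resp. `T`
    have h0 : (List.ofFn fun j : Fin (2 ^ n) => (Ms t ⟨j, lt_two_pow_succ j.isLt⟩).map
        (Polynomial.eval (x ⟨j, lt_two_pow_succ j.isLt⟩))).prod ∈
        Submodule.span K (Set.range fun s : K => (Rf t).map (Polynomial.eval s)) := by
      have h := hα'' (Sum.inl t)
        (Submodule.subset_span ⟨fun j => x ⟨j, lt_two_pow_succ j.isLt⟩, rfl⟩)
      simp only [Sum.elim_inl] at h
      have hEq : (fun s : K => (Rf t).map (Polynomial.eval s)) = fun s : K =>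
          (List.ofFn fun j => (Ms t ⟨j, lt_two_pow_succ j.isLt⟩).map (Polynomial.eval
            (MvPolynomial.eval (Fin.snoc α'' s : Fin (n + 1) → K)
              (fsGenCoord n w d ω β (binaryOrder n j))))).prod :=
        funext fun s => hReval t s
      rw [hEq]
      exact h
    have h1 : (List.ofFn fun j : Fin (2 ^ n) => (Ms t ⟨2 ^ n + j, add_lt_two_pow_succ j.isLt⟩).map
        (Polynomial.eval (x ⟨2 ^ n + j, add_lt_two_pow_succ j.isLt⟩))).prod ∈
        Submodule.span K (Set.range fun s : K => (Tf t).map (Polynomial.eval s)) := by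
      have h := hα'' (Sum.inr t)
        (Submodule.subset_span ⟨fun j => x ⟨2 ^ n + j, add_lt_two_pow_succ j.isLt⟩, rfl⟩)
      simp only [Sum.elim_inr] at h
      have hEq : (fun s : K => (Tf t).map (Polynomial.eval s)) = fun s : K =>
          (List.ofFn fun j => (Ms t ⟨2 ^ n + j, add_lt_two_pow_succ j.isLt⟩).map (Polynomial.eval
            (MvPolynomial.eval (Fin.snoc α'' s : Fin (n + 1) → K)
              (fsGenCoord n w d ω β (binaryOrder n j))))).prod :=
        funext fun s => hTeval t s
      rw [hEq]
      exact h
    have h01 := Submodule.mul_mem_mul h0 h1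
    rw [Submodule.span_mul_span] at h01
    have hsub : Set.range (fun s : K => (Rf t).map (Polynomial.eval s)) *
        Set.range (fun s : K => (Tf t).map (Polynomial.eval s)) ⊆
        Set.range (fun xy : K × K =>
          (Rf t).map (Polynomial.eval xy.1) * (Tf t).map (Polynomial.eval xy.2)) := by
      rintro _ ⟨_, ⟨s₁, rfl⟩, _, ⟨s₂, rfl⟩, rfl⟩
      exact ⟨(s₁, s₂), rfl⟩
    have h2 := hgood t (Submodule.span_mono hsub h01)
    refine (Submodule.span_mono ?_) h2
    rintro _ ⟨z, rfl⟩
    refine ⟨z, ?_⟩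
    exact listProd_ofFn_two_pow_succ (fun j : Fin (2 ^ (n + 1)) => (Ms t j).map
      (Polynomial.eval (MvPolynomial.eval
        (Fin.snoc (Fin.snoc α'' (ω⁻¹ * α) : Fin (n + 1) → K) z : Fin (n + 2) → K)
        (fsGenCoord (n + 1) w d ω β (binaryOrder (n + 1) j)))))

end Span

/-! ### Corner `d = 0`: an individual-degree-`0` roABP is a nonzero constant -/

section DegreeZero

variable {F : Type*} [Field F]

open Literature.Barriers.ValiantsHypothesis in
/-- **Degree `0`:** a width-`w`, individual-degree-`0` roABP computes a constant (every layer is a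
constant matrix), so EVERY polynomial map is a hitting-set generator for this class (the
substitution does not touch constants). [cite: ForbesShpilkaVolk2018, §5.3 (definition of roABP: "each entry … is a univariate, degree `d` polynomial"), case `d = 0`]
locator: paper:arxiv-1701.05328 p0019.txt:L79 -/
theorem isHittingSetGenerator_of_isROABP_zero {σ τ : Type*} {Mset : Set (σ →₀ ℕ)} {N w : ℕ}
    (π : Fin N ≃ Mset) (G : Mset → MvPolynomial τ F) :
    IsHittingSetGenerator {D : MvPolynomial Mset F | IsROABP F w 0 π D} G := by
  classical
  intro D hD hD0
  obtain ⟨hw, M, hM, hDM⟩ := hD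
  choose p hpdeg hpM using hM
  -- every layer is the constant matrix of the constant coefficients
  have hMeq : M = fun i => (Matrix.of fun a b => (p i a b).coeff 0).map
      (C : F →+* MvPolynomial Mset F) := by
    funext i
    refine Matrix.ext fun a b => ?_
    rw [Matrix.map_apply, Matrix.of_apply, hpM i a b]
    conv_lhs => rw [Polynomial.eq_C_of_natDegree_le_zero (hpdeg i a b)]
    rw [Polynomial.aeval_C, MvPolynomial.algebraMap_eq]
  have hDC : D = C (((List.ofFn fun i => Matrix.of fun a b => (p i a b).coeff 0).prod) ⟨0, hw⟩ ⟨0, hw⟩) := by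
    rw [hDM, hMeq, ← FS2013.map_listProd_ofFn, Matrix.map_apply]
  intro h
  rw [hDC, MvPolynomial.bind₁_C_right, MvPolynomial.C_eq_zero] at h
  exact hD0 (by rw [hDC, h, MvPolynomial.C_0])

end DegreeZero

/-! ### Corner `w = 1`: a width-`1` roABP is a product of univariates -/

section WidthOne

variable {F : Type*} [Field F]

/-- The `(0,0)` entry of an ordered product of `1 × 1` matrices is the product of the entries
(a width-`1` roABP "`(∏_i M_i(X_{σ(i)}))_{1,1}`" is a product of univariates).
[cite: ForbesShpilkaVolk2018, §5.3 (definition of roABP), width-1 case] locator: paper:arxiv-1701.05328 p0019.txt:L79 -/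
theorem listProd_ofFn_apply_fin_one {R : Type*} [CommRing R] :
    ∀ (k : ℕ) (N : Fin k → Matrix (Fin 1) (Fin 1) R), (List.ofFn N).prod 0 0 = ∏ i, N i 0 0
  | 0, N => by rw [List.ofFn_zero, List.prod_nil, Matrix.one_apply_eq, Fintype.prod_empty]
  | k + 1, N => by
    rw [List.ofFn_succ, List.prod_cons, Matrix.mul_apply, Fin.sum_univ_one,
      listProd_ofFn_apply_fin_one k, Fin.prod_univ_succ]

/-- **The width-`1` generator values.** For `w = 1` there is a single node and a single twist index
(`ℓ ∈ ⟦1⟧`), the Lagrange polynomial is `1`, and the recursion (arXiv Lemma 17) collapses to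
`𝒢^{(n+1)}_m(v) = ω v_0` if the FIRST bit `m_0 = 0`, `= (ω v_0)^{d}` (`= (ω v_0)^{2^0·d·1²}`) else —
independently of all later seeds. [cite: ForbesShpilkaVolk2018, Lemma 55 eq. (7.1) (case `w = 1`); ForbesShpilka2013, Lemma 17 (arXiv numbering; §3.2)]
locator: paper:arxiv-1701.05328 chunk p0023.txt:L19–L25; paper:arxiv-1209.2408 p0015.txt:L50–L58 -/
theorem eval_fsGenCoord_width_one (d : ℕ) (ω : F) (β : Fin (1 ^ 2) → F) :
    ∀ (n : ℕ) (j : Fin (2 ^ (n + 1))) (v : Fin (n + 2) → F),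
      MvPolynomial.eval v (fsGenCoord (n + 1) 1 d ω β (binaryOrder (n + 1) j)) =
        if (j : ℕ) % 2 = 0 then ω ^ ((0 : ℕ) + 1) * v 0
        else (ω ^ ((0 : ℕ) + 1) * v 0) ^ (2 ^ 0 * d * 1 ^ 2) := by
  classical
  -- the single twist index and the trivial Lagrange polynomial
  let k₀ : Fin (1 ^ 2) := ⟨0, by norm_num⟩
  have hsub : ∀ k : Fin (1 ^ 2), k = k₀ := fun k => Fin.ext (by
    have h := k.isLt; simp only [Nat.one_pow] at h; show (k : ℕ) = 0; omega)
  have huniv : (Finset.univ : Finset (Fin (1 ^ 2))) = {k₀} :=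
    Finset.eq_singleton_iff_unique_mem.mpr ⟨Finset.mem_univ _, fun k _ => hsub k⟩
  have hbasis : fsBasis β (some k₀) = 1 := by
    show Lagrange.basis Finset.univ β k₀ = 1
    rw [huniv, Lagrange.basis_singleton]
  -- one level of the recursion, evaluated: `𝒢^{(n+1)}_{m'}(v) = 𝒢^{(n)}_m(σ(v))`
  have hstep : ∀ (n : ℕ) (m' : multilinearMonomials (n + 1)) (m : multilinearMonomials n)
      (hm : ∀ i : Fin n, (m : Fin n →₀ ℕ) i = (m' : Fin (n + 1) →₀ ℕ) i.castSucc)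
      (v : Fin (n + 2) → F),
      MvPolynomial.eval v (fsGenCoord (n + 1) 1 d ω β m') =
        MvPolynomial.eval (fun i : Fin (n + 1) => MvPolynomial.eval v
          ((Fin.snoc (fun j : Fin n => (X j.castSucc.castSucc : MvPolynomial (Fin (n + 2)) F))
            ((if (m' : Fin (n + 1) →₀ ℕ) (Fin.last n) = 0 then
                C (ω ^ ((k₀ : ℕ) + 1)) * X (Fin.last n).castSucc
             else (C (ω ^ ((k₀ : ℕ) + 1)) * X (Fin.last n).castSucc) ^ (2 ^ n * d * 1 ^ 2)) :
              MvPolynomial (Fin (n + 2)) F) : Fin (n + 1) → MvPolynomial (Fin (n + 2)) F) i))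
          (fsGenCoord n 1 d ω β m) := by
    intro n m' m hm v
    rw [fsGenCoord_succ n 1 d ω β m' m hm,
      Finset.sum_eq_single_of_mem k₀ (Finset.mem_univ _) (fun k _ hk => absurd (hsub k) hk),
      hbasis, map_one, mul_one, MvPolynomial.aeval_eq_bind₁]
    show MvPolynomial.eval₂Hom (RingHom.id F) v (MvPolynomial.bind₁ _ _) = _
    rw [MvPolynomial.eval₂Hom_bind₁]
    rfl
  intro n
  induction n with
  | zero =>
    intro j v
    have hm : ∀ i : Fin 0, ((binaryOrder 0 ⟨0, by norm_num⟩ : multilinearMonomials 0) : Fin 0 →₀ ℕ) i =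
        ((binaryOrder (0 + 1) j : multilinearMonomials (0 + 1)) : Fin (0 + 1) →₀ ℕ) i.castSucc :=
      fun i => i.elim0
    rw [hstep 0 _ _ hm v, fsGenCoord_zero, MvPolynomial.eval_X,
      show (0 : Fin (0 + 1)) = Fin.last 0 from rfl, Fin.snoc_last]
    have hbit : (((binaryOrder (0 + 1) j : multilinearMonomials (0 + 1)) : Fin (0 + 1) →₀ ℕ)
        (Fin.last 0) = 0) ↔ (j : ℕ) % 2 = 0 := by
      rw [binaryOrder_apply, Fin.val_last, pow_zero, Nat.div_one]
    have hX : MvPolynomial.eval v (X (Fin.last 0).castSucc : MvPolynomial (Fin (0 + 2)) F) = v 0 := by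
      rw [MvPolynomial.eval_X]; rfl
    by_cases h : (j : ℕ) % 2 = 0
    · rw [if_pos (hbit.mpr h), if_pos h, map_mul, MvPolynomial.eval_C, hX]
    · rw [if_neg (fun h' => h (hbit.mp h')), if_neg h, map_pow, map_mul, MvPolynomial.eval_C, hX]
  | succ n ih =>
    intro j v
    -- split the index: `j = j'` (last bit `0`) or `j = 2^{n+1} + j'` (last bit `1`)
    have hX0 : ∀ q : MvPolynomial (Fin (n + 3)) F, MvPolynomial.eval v
        ((Fin.snoc (fun j : Fin (n + 1) => (X j.castSucc.castSucc : MvPolynomial (Fin (n + 3)) F))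
          q : Fin (n + 2) → MvPolynomial (Fin (n + 3)) F) 0) = v 0 := by
      intro q
      rw [show (0 : Fin (n + 2)) = (0 : Fin (n + 1)).castSucc from rfl, Fin.snoc_castSucc,
        MvPolynomial.eval_X]
      rfl
    by_cases hj : (j : ℕ) < 2 ^ (n + 1)
    · set j' : Fin (2 ^ (n + 1)) := ⟨j, hj⟩ with hj'
      have hjj : j = ⟨(j' : ℕ), lt_two_pow_succ j'.isLt⟩ := Fin.ext rfl
      rw [hjj, hstep (n + 1) _ (binaryOrder (n + 1) j') (fun i => (binaryOrder_succ_lower j' i).symm) v,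
        ih j', hX0]
    · obtain ⟨j', hj'⟩ : ∃ j' : Fin (2 ^ (n + 1)), (j : ℕ) = 2 ^ (n + 1) + j' := by
        refine ⟨⟨j - 2 ^ (n + 1), ?_⟩, ?_⟩
        · have h1 := j.isLt
          have h2 : 2 ^ (n + 1 + 1) = 2 ^ (n + 1) + 2 ^ (n + 1) := by rw [pow_succ, mul_two]
          omega
        · simp only; omega
      have hjj : j = ⟨2 ^ (n + 1) + (j' : ℕ), add_lt_two_pow_succ j'.isLt⟩ := Fin.ext hj'
      rw [hjj, hstep (n + 1) _ (binaryOrder (n + 1) j') (fun i => (binaryOrder_succ_upper j' i).symm) v,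
        ih j', hX0]
      have hmod : (2 ^ (n + 1) + (j' : ℕ)) % 2 = (j' : ℕ) % 2 := by
        have h2 : 2 ^ (n + 1) = 2 * 2 ^ n := by rw [pow_succ']
        omega
      simp only [hmod]

/-- `p ∘ q ≠ 0` for `p ≠ 0` and `q` non-constant. [folklore] -/
private theorem comp_ne_zero_of_natDegree_pos {p q : Polynomial F} (hp : p ≠ 0)
    (hq : 0 < q.natDegree) : p.comp q ≠ 0 := by
  intro h
  rcases Polynomial.comp_eq_zero_iff.mp h with h' | ⟨-, hqC⟩
  · exact hp h'
  · rw [hqC, Polynomial.natDegree_C] at hq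
    exact lt_irrefl 0 hq

open Literature.Barriers.ValiantsHypothesis in
/-- **Width `1` (over an infinite field):** the generator `𝒢^{FS}` with `w = 1` hits every nonzero
width-`1` roABP of individual degree `≤ d` (`d ≥ 1`): such an roABP is a product of nonzero
univariates `∏_j p_j(X_j)`, composed with `𝒢^{FS}` it becomes `∏_j p_j(ω v_0)` resp. `p_j((ω v_0)^d)`,
nonzero for `v_0` off finitely many values. [cite: ForbesShpilkaVolk2018, Lemma 55 (seq.; = ToC Lemma 7.1), case `w = 1`]
locator: paper:arxiv-1701.05328 chunk p0023.txt:L9–L25 -/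
theorem isHittingSetGenerator_fsGenCoord_width_one [Infinite F] (n d : ℕ) (hd : 1 ≤ d) (ω : F)
    (β : Fin (1 ^ 2) → F) (hω0 : ω ≠ 0) :
    IsHittingSetGenerator
      {D : MvPolynomial (multilinearMonomials n) F | IsROABP F 1 d (binaryOrder n) D}
      (fsGenCoord n 1 d ω β) := by
  classical
  refine IsHittingSetGenerator.of_hits fun D hD hD0 => ?_
  obtain ⟨hw, M, hM, hDM⟩ := hD
  choose p hpdeg hpM using hM
  have hMeq : M = fun i => Matrix.of fun a b =>
      Polynomial.aeval (X (binaryOrder n i) : MvPolynomial (multilinearMonomials n) F) (p i a b) := by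
    funext i
    exact Matrix.ext fun a b => by rw [Matrix.of_apply]; exact hpM i a b
  have h00 : (⟨0, hw⟩ : Fin 1) = 0 := rfl
  -- evaluation of `D` = product of the univariate values
  have heval : ∀ y : multilinearMonomials n → F, MvPolynomial.eval y D =
      ∏ i : Fin (2 ^ n), (p i 0 0).eval (y (binaryOrder n i)) := by
    intro y
    rw [hDM, hMeq, h00, FS2013.eval_listProd_apply, listProd_ofFn_apply_fin_one]
    rfl
  -- a point where `D` does not vanish; hence all `p_i ≠ 0`
  have hex : ∃ y : multilinearMonomials n → F, MvPolynomial.eval y D ≠ 0 := by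
    by_contra h
    have h' : ∀ y : multilinearMonomials n → F, MvPolynomial.eval y D = 0 :=
      fun y => not_not.mp (not_exists.mp h y)
    exact hD0 (MvPolynomial.funext fun y => by rw [h' y, map_zero])
  obtain ⟨y, hy⟩ := hex
  have hp0 : ∀ i, p i 0 0 ≠ 0 := by
    intro i hi
    apply hy
    rw [heval]
    exact Finset.prod_eq_zero (Finset.mem_univ i) (by rw [hi, Polynomial.eval_zero])
  cases n with
  | zero =>
    -- one variable, `𝒢 = y_0`: the seed `y` itself
    have hm0 : ∀ m : multilinearMonomials 0, m = binaryOrder 0 ⟨0, by norm_num⟩ := fun m => by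
      rw [← (binaryOrder 0).apply_symm_apply m]
      exact congrArg (binaryOrder 0)
        (Fin.ext (by have := ((binaryOrder 0).symm m).isLt; simp only [pow_zero] at this; omega))
    refine ⟨fun _ => y (binaryOrder 0 ⟨0, by norm_num⟩), ?_⟩
    have hout : genOutput (fsGenCoord 0 1 d ω β) (fun _ => y (binaryOrder 0 ⟨0, by norm_num⟩)) = y := by
      funext m
      rw [genOutput_apply, fsGenCoord_zero, MvPolynomial.eval_X, ← hm0 m]
    rw [hout]
    exact hy
  | succ n =>
    -- the values of the generator are `c t` and `(c t)^E`, `c = ω`, `E = d`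
    set c : F := ω ^ ((0 : ℕ) + 1) with hc
    set E : ℕ := 2 ^ 0 * d * 1 ^ 2 with hE
    have hc0 : c ≠ 0 := pow_ne_zero _ hω0
    have hE0 : 0 < E := by rw [hE]; simp only [pow_zero, one_mul, one_pow, mul_one]; exact hd
    -- the polynomial whose non-roots are the good first seeds
    set Q : Polynomial F := ∏ i : Fin (2 ^ (n + 1)),
      ((p i 0 0).comp (Polynomial.C c * Polynomial.X) *
        (p i 0 0).comp ((Polynomial.C c * Polynomial.X) ^ E)) with hQ
    have hq1 : 0 < (Polynomial.C c * Polynomial.X : Polynomial F).natDegree := by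
      rw [Polynomial.natDegree_C_mul_X c hc0]; exact one_pos
    have hq2 : 0 < ((Polynomial.C c * Polynomial.X) ^ E : Polynomial F).natDegree := by
      rw [Polynomial.natDegree_pow, Polynomial.natDegree_C_mul_X c hc0, mul_one]; exact hE0
    have hQ0 : Q ≠ 0 := by
      rw [hQ]
      refine Finset.prod_ne_zero_iff.mpr fun i _ => mul_ne_zero ?_ ?_
      · exact comp_ne_zero_of_natDegree_pos (hp0 i) hq1
      · exact comp_ne_zero_of_natDegree_pos (hp0 i) hq2
    obtain ⟨t, ht⟩ := Infinite.exists_notMem_finset Q.roots.toFinset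
    have hQt : Q.eval t ≠ 0 := by
      intro h
      exact ht (Multiset.mem_toFinset.mpr ((Polynomial.mem_roots hQ0).mpr h))
    have hfac : ∀ i : Fin (2 ^ (n + 1)),
        (p i 0 0).eval (c * t) ≠ 0 ∧ (p i 0 0).eval ((c * t) ^ E) ≠ 0 := by
      intro i
      have hQt' := hQt
      rw [hQ, Polynomial.eval_prod] at hQt'
      have h := (Finset.prod_ne_zero_iff.mp hQt') i (Finset.mem_univ _)
      rw [Polynomial.eval_mul, mul_ne_zero_iff, Polynomial.eval_comp, Polynomial.eval_comp,
        Polynomial.eval_pow, Polynomial.eval_mul, Polynomial.eval_C, Polynomial.eval_X] at h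
      exact h
    refine ⟨fun _ => t, ?_⟩
    rw [heval]
    refine Finset.prod_ne_zero_iff.mpr fun i _ => ?_
    rw [genOutput_apply, eval_fsGenCoord_width_one d ω β n i]
    split_ifs
    · exact (hfac i).1
    · exact (hfac i).2

end WidthOne

end FS2013

/-! ### The generator theorem with FSV's parameters -/

variable {F : Type*} [Field F]

open Literature.Barriers.ValiantsHypothesis in
/-- **[ForbesShpilkaVolk2018, Lemma 55] with the printed parameters, main case `w ≥ 2`, `d ≥ 1`,
over an infinite field (= [ForbesShpilka2013, Lemma 20 (arXiv) "`𝒢_d` is a generator"]).** For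
distinct nodes `β`, `ω ≠ 0` with `ω^k ≠ 1` for `0 < k < (2ⁿ d w²)²`, FSV's map `fsGenCoord n w d ω β`
(eq. (7.1), exponent `2^{i-1} d w²`) is a hitting-set generator for width-`w`, individual-degree-`d`
roABPs in the order `X_1, …, X_N` (`N = 2ⁿ`). Same proof as
`ForbesShpilkaVolk2018_lemma55_safe_of_infinite` with the sharp span lemma.
[cite: ForbesShpilkaVolk2018, Lemma 55 (seq.; = ToC Lemma 7.1); ForbesShpilka2013, Lemma 20 (arXiv numbering; §3.2)]
locator: paper:arxiv-1701.05328 chunk p0023.txt:L9–L25; paper:arxiv-1209.2408 p0016.txt:L64 – p0017.txt:L4 -/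
theorem ForbesShpilkaVolk2018_lemma55_of_infinite_main [Infinite F] (n w d : ℕ) (hw2 : 2 ≤ w)
    (hd : 1 ≤ d) (ω : F)
    (β : Fin (w ^ 2) → F) (hβ : Function.Injective β) (hω0 : ω ≠ 0)
    (hord : ∀ k : ℕ, 0 < k → k < (2 ^ n * d * w ^ 2) ^ 2 → ω ^ k ≠ 1) :
    IsHittingSetGenerator
      {D : MvPolynomial (multilinearMonomials n) F | IsROABP F w d (binaryOrder n) D}
      (fsGenCoord n w d ω β) := by
  classical
  refine IsHittingSetGenerator.of_hits fun D hD hD0 => ?_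
  obtain ⟨hw, M, hM, hDM⟩ := hD
  choose p hpdeg hpM using hM
  -- the layers as matrices of univariate polynomials
  have hMeq : M = fun i => Matrix.of fun a b =>
      Polynomial.aeval (X (binaryOrder n i) : MvPolynomial (multilinearMonomials n) F) (p i a b) := by
    funext i
    exact Matrix.ext fun a b => by rw [Matrix.of_apply]; exact hpM i a b
  -- a point where `D` does not vanish (infinite field)
  have hex : ∃ y : multilinearMonomials n → F, MvPolynomial.eval y D ≠ 0 := by
    by_contra h
    have h' : ∀ y : multilinearMonomials n → F, MvPolynomial.eval y D = 0 :=
      fun y => not_not.mp (not_exists.mp h y)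
    exact hD0 (MvPolynomial.funext fun y => by rw [h' y, map_zero])
  obtain ⟨y, hy⟩ := hex
  -- span preservation (Lemma 19) for the one-member family of univariate layers
  have hω : Set.InjOn (fun k : ℕ => ω ^ k)
      (Set.Iio ((2 ^ n * d * w ^ 2) * (2 ^ n * d * w ^ 2))) := by
    rw [← pow_two]
    exact FS2012.pow_injOn_Iio_of_forall_pow_ne_one hω0 hord
  obtain ⟨α', hα'⟩ := FS2013.span_layerProd_le_span_lastSeed_sharp (K := F) (d := d) hw2 hd hω0 hβ n hω Unit
    (fun _ i => Matrix.of (p i)) (fun _ i a b => hpdeg i a b)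
  have hle := hα' ()
  -- the `(0,0)` entries along the generator cannot all vanish
  by_contra hall
  have hall' : ∀ a : Fin (n + 1) → F,
      MvPolynomial.eval (genOutput (fsGenCoord n w d ω β) a) D = 0 :=
    fun a => not_not.mp (not_exists.mp hall a)
  have hzero : ∀ s : F, ((List.ofFn fun i => (Matrix.of (p i)).map (Polynomial.eval
      (MvPolynomial.eval (Fin.snoc α' s : Fin (n + 1) → F)
        (fsGenCoord n w d ω β (binaryOrder n i))))).prod) ⟨0, hw⟩ ⟨0, hw⟩ = 0 := by
    intro s
    have h := hall' (Fin.snoc α' s)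
    rw [hDM, hMeq, FS2013.eval_listProd_apply] at h
    simpa only [genOutput_apply] using h
  have hker : ∀ A ∈ Submodule.span F (Set.range fun s : F =>
      (List.ofFn fun i => (Matrix.of (p i)).map (Polynomial.eval
        (MvPolynomial.eval (Fin.snoc α' s : Fin (n + 1) → F)
          (fsGenCoord n w d ω β (binaryOrder n i))))).prod),
      (A : Matrix (Fin w) (Fin w) F) ⟨0, hw⟩ ⟨0, hw⟩ = 0 := by
    intro A hA
    induction hA using Submodule.span_induction with
    | mem A hA =>
      obtain ⟨s, rfl⟩ := hA
      exact hzero s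
    | zero => rfl
    | add A B _ _ hA hB => rw [Matrix.add_apply, hA, hB, add_zero]
    | smul c A _ hA => rw [Matrix.smul_apply, hA, smul_zero]
  have hmem := hle (Submodule.subset_span ⟨fun i => y (binaryOrder n i), rfl⟩)
  have h00 := hker _ hmem
  apply hy
  rw [hDM, hMeq, FS2013.eval_listProd_apply]
  exact h00


open Literature.Barriers.ValiantsHypothesis in
/-- **[ForbesShpilkaVolk2018, Lemma 55] with the printed parameters, over an infinite field, ALL
widths and degrees:** `w ≥ 2, d ≥ 1` by span preservation; `w = 1` products of univariates; `d = 0`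
constants; `w = 0` is no roABP. [cite: ForbesShpilkaVolk2018, Lemma 55 (seq.; = ToC Lemma 7.1)]
locator: paper:arxiv-1701.05328 chunk p0023.txt:L9–L25 -/
theorem ForbesShpilkaVolk2018_lemma55_of_infinite [Infinite F] (n w d : ℕ) (ω : F)
    (β : Fin (w ^ 2) → F) (hβ : Function.Injective β) (hω0 : ω ≠ 0)
    (hord : ∀ k : ℕ, 0 < k → k < (2 ^ n * d * w ^ 2) ^ 2 → ω ^ k ≠ 1) :
    IsHittingSetGenerator
      {D : MvPolynomial (multilinearMonomials n) F | IsROABP F w d (binaryOrder n) D}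
      (fsGenCoord n w d ω β) := by
  rcases Nat.eq_zero_or_pos d with rfl | hd
  · exact FS2013.isHittingSetGenerator_of_isROABP_zero _ _
  rcases Nat.lt_or_ge w 2 with hw | hw
  · interval_cases w
    · intro D hD _
      obtain ⟨hw0, -⟩ := hD
      exact absurd hw0 (lt_irrefl 0)
    · exact FS2013.isHittingSetGenerator_fsGenCoord_width_one n d hd ω β hω0
  · exact ForbesShpilkaVolk2018_lemma55_of_infinite_main n w d hw hd ω β hβ hω0 hord

open Literature.Barriers.ValiantsHypothesis in
/-- **FSV 2018 Lemma 55 (ToC Lemma 7.1) AS PRINTED — DISCHARGED (every field):** "Let `n ∈ ℕ` and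
`N = 2ⁿ`. … Let `ω ∈ 𝔽` be of multiplicative order at least `(N d w²)²`, and `β_1, …, β_{w²}` be
distinct elements of `𝔽` … the polynomial map `𝒢^{FS} : 𝔽^{n+1} → 𝔽^N` [eq. (7.1), `fsGenCoord n w d`]
is a generator for width `w`, individual degree `d`, `N`-variate roABPs, in variable order
`X_1, X_2, …, X_N`." The verbatim named fact `ForbesShpilkaVolk2018_lemma55 F` holds for every field
`F` (base change to the infinite field `Frac(F[u])`, where `ForbesShpilkaVolk2018_lemma55_of_infinite`
applies; a hitting-set generator statement is a polynomial identity). This settles the cell's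
caveat B13 (FSV's `d`-convention vs [FS13]'s `< n`): the printed constants are correct.
[cite: ForbesShpilkaVolk2018, Lemma 55 (seq.; = arXiv v2 / ToC Lemma 7.1); ForbesShpilka2013, Construction 15, Lemmas 16–20, Theorem 21 (arXiv numbering; §3.2)]
locator: paper:arxiv-1701.05328 chunk p0023.txt:L9–L25; paper:arxiv-1209.2408 p0015.txt:L19 – p0017.txt:L4 -/
theorem ForbesShpilkaVolk2018_lemma55_allFields (F : Type*) [Field F] :
    ForbesShpilkaVolk2018_lemma55 F := by
  classical
  intro n w d ω β hβ hω0 hord D hD hD0 hcomp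
  -- base change to the infinite field `K = Frac(F[u])`
  let K := FractionRing (Polynomial F)
  let ι : F →+* K := algebraMap F K
  have hι : Function.Injective ι := (algebraMap F K).injective
  haveI : Infinite K := Infinite.of_injective _
    (IsFractionRing.injective (Polynomial F) (FractionRing (Polynomial F)))
  have hD' : IsROABP K w d (binaryOrder n) (MvPolynomial.map ι D) := FS2013.isROABP_map ι _ hD
  have hD0' : MvPolynomial.map ι D ≠ 0 := fun h =>
    hD0 (MvPolynomial.map_injective ι hι (by rw [h, map_zero]))
  have hβ' : Function.Injective (ι ∘ β) := hι.comp hβ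
  have hω0' : ι ω ≠ 0 := fun h => hω0 (hι (by rw [h, map_zero]))
  have hord' : ∀ k : ℕ, 0 < k → k < (2 ^ n * d * w ^ 2) ^ 2 → ι ω ^ k ≠ 1 := by
    intro k hk hk' h
    refine hord k hk hk' (hι ?_)
    rw [map_pow, h, map_one]
  have hgen := ForbesShpilkaVolk2018_lemma55_of_infinite (F := K) n w d (ι ω) (ι ∘ β) hβ'
    hω0' hord' _ hD' hD0'
  apply hgen
  have hnat : fsGenCoord n w d (ι ω) (ι ∘ β) =
      fun m => MvPolynomial.map ι (fsGenCoord n w d ω β m) :=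
    funext fun m => (FS2013.map_fsGenCoord ι n w d ω β m).symm
  rw [hnat, ← MvPolynomial.map_bind₁, hcomp, map_zero]

/-- `ForbesShpilkaVolk2018_lemma55` holds for all parameters — `_holds` alias of `ForbesShpilkaVolk2018_lemma55_allFields` above under the fact's exact name
(appended 2026-08-28, D-0026 bookkeeping: the proof term is the existing theorem of this file; no statement,
definition or attribute is edited; no new named fact; the ledger's debt table listed the fact
unproved). [cite: ForbesShpilkaVolk2018, Lemma 55 (seq.; = arXiv v2 / ToC Lemma 7.1); ForbesShpilka2013, Construction 15, Lemmas 16–20, Theorem 21 (arXiv numbering; §3.2)] -/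
theorem _root_.Literature.Computability.AlgebraicComplexity.ForbesShpilkaVolk2018_lemma55_holds
    (F : Type*) [Field F] :
    ForbesShpilkaVolk2018_lemma55 F :=
  _root_.Literature.Computability.AlgebraicComplexity.ForbesShpilkaVolk2018_lemma55_allFields F

/-! ### The printed corollaries, hypothesis-free -/

open Literature.Barriers.ValiantsHypothesis in
/-- **FSV Cor. 59 — hypothesis-free form of `ForbesShpilkaVolk2018_cor59` (Lemma 55 fed in):** "The
Forbes–Shpilka generator given in Lemma 55 is a width `w²`-roABP succinct generator for degree `d`
roABPs that read the variables in order `X_1, X_2, …, X_N`."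
[cite: ForbesShpilkaVolk2018, Cor. 59 (seq.; = arXiv v2 Cor. 7.7, ToC Cor. 7.5)]
locator: paper:arxiv-1701.05328 chunk p0023.txt:L88–94; ToC 14(18) Cor. 7.5 p. 33 -/
theorem ForbesShpilkaVolk2018_cor59_unconditional {n w : ℕ} (hw : 0 < w) (hn : 0 < n) (d : ℕ) {ω : F}
    {β : Fin (w ^ 2) → F} (hβ : Function.Injective β) (hω : ω ≠ 0)
    (hord : ∀ k : ℕ, 0 < k → k < (2 ^ n * d * w ^ 2) ^ 2 → ω ^ k ≠ 1) :
    IsHittingSetGenerator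
        {D : MvPolynomial (multilinearMonomials n) F | IsROABP F w d (binaryOrder n) D}
        (fsGenCoord n w d ω β) ∧
      IsSuccinctGenerator (multilinearMonomials n)
        {f : MvPolynomial (Fin n) F | IsROABP F (w ^ 2) 1 (Equiv.refl (Fin n)) f}
        (fsGenCoord n w d ω β) :=
  ForbesShpilkaVolk2018_cor59 (ForbesShpilkaVolk2018_lemma55_allFields F) hw hn d hβ hω hord

open Literature.Barriers.ValiantsHypothesis in
/-- **FSV Cor. 60 / §7.1 — hypothesis-free form of `ForbesShpilkaVolk2018_cor60` (Lemma 55 fed in):** over an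
infinite field, for admissible `ω, β`, the width-`w²` individual-degree-`1` `n`-variate roABPs (in some
order) are a succinct hitting set for width-`w`, individual-degree-`d`, `N = 2ⁿ`-variate roABPs in any
monomial-compatible order. [cite: ForbesShpilkaVolk2018, Cor. 60 (seq.; = arXiv v2 Cor. 7.8, ToC Cor. 7.6) and §7.1]
locator: paper:arxiv-1701.05328 chunk p0024.txt:L1–6; ToC 14(18) Cor. 7.6 p. 34 -/
theorem ForbesShpilkaVolk2018_cor60_unconditional [Infinite F] {n w : ℕ} (hw : 0 < w) (hn : 0 < n) (d : ℕ)
    {ω : F} {β : Fin (w ^ 2) → F} (hβ : Function.Injective β) (hω : ω ≠ 0)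
    (hord : ∀ k : ℕ, 0 < k → k < (2 ^ n * d * w ^ 2) ^ 2 → ω ^ k ≠ 1) :
    IsSuccinctHittingSet (multilinearMonomials n)
      {f : MvPolynomial (Fin n) F | ∃ σ : Equiv.Perm (Fin n), IsROABP F (w ^ 2) 1 σ f}
      {D : MvPolynomial (multilinearMonomials n) F |
        ∃ σ : Equiv.Perm (Fin n), IsROABP F w d (monomialCompatibleOrder σ) D} :=
  ForbesShpilkaVolk2018_cor60 (ForbesShpilkaVolk2018_lemma55_allFields F) hw hn d hβ hω hord

open Literature.Barriers.ValiantsHypothesis in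
/-- **FSV Cor. 60 as printed — hypothesis-free form of `ForbesShpilkaVolk2018_cor60'` (Lemma 55 fed in):**
"There exists a width-`w²` roABP succinct hitting set for the class of width `w`, `N` variate, and
degree `d` roABPs that read the variables in a monomial compatible ordering" (`n, w ≥ 1`, infinite
field). [cite: ForbesShpilkaVolk2018, Cor. 60 (seq.; = arXiv v2 Cor. 7.8, ToC Cor. 7.6)]
locator: paper:arxiv-1701.05328 chunk p0024.txt:L5–6; ToC 14(18) Cor. 7.6 p. 34 -/
theorem ForbesShpilkaVolk2018_cor60'_unconditional [Infinite F] {n w : ℕ} (hw : 0 < w) (hn : 0 < n) (d : ℕ) :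
    IsSuccinctHittingSet (multilinearMonomials n)
      {f : MvPolynomial (Fin n) F | ∃ σ : Equiv.Perm (Fin n), IsROABP F (w ^ 2) 1 σ f}
      {D : MvPolynomial (multilinearMonomials n) F |
        ∃ σ : Equiv.Perm (Fin n), IsROABP F w d (monomialCompatibleOrder σ) D} :=
  ForbesShpilkaVolk2018_cor60' (ForbesShpilkaVolk2018_lemma55_allFields F) hw hn d

end Literature.Computability.AlgebraicComplexity
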